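import Literature.AlgebraicGeometry.Limits.SmoothProjectiveIntegralModel
import Literature.RingTheory.CompleteLocalRings.WittVectorEmbeddingComplex
import Literature.AlgebraicGeometry.Motives.CrystallineRealization
import HarnessLib

/-!
# Smooth proper `W(𝔽̄_p)`-models of a complex smooth projective variety, for all large `p`

Topic `Literature/AlgebraicGeometry/Motives` (next to the tree's carriers `WittScheme.specialFibre`,
`WittScheme.genericFibre`, `WittScheme.IsSmoothProperModel` of `CrystallineRealization`). The
"integral model at a large unramified prime" step of reduction-modulo-`p` arguments for COMPLEX
varieties (Maulik–Poonen 2012, §4: spread `X` out over a finitely generated `ℤ`-algebra, embed that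
algebra into `ℤ_p` — here `W(𝔽̄_p)` — for a suitable prime, and base change; compare Serre, *How to
use finite fields for problems concerning infinite fields*):

* `exists_isSmoothProperModel_wittVector` — for a smooth projective complex variety `X` of
  dimension `n` and a bound `N` there are a prime `p ≥ N`, the field `κ = 𝔽̄_p`
  (`AlgebraicClosure (ZMod p)`), a `W(κ)`-scheme `𝒴` which is a smooth proper model of relative
  dimension `n` with smooth projective geometrically irreducible fibres
  (`WittScheme.IsSmoothProperModel n 𝒴`), and an embedding `ι : Frac W(κ) → ℂ` with an
  isomorphism of `ℂ`-schemes `𝒴_K ⊗_{K, ι} ℂ ≅ X`.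

Proof: `X ≅ Y ×_T Spec ℂ` for a smooth projective `Y ↪ ℙᴺ_T` over a finitely generated
`ℤ`-algebra `T ⊆ ℂ` (`Limits.exists_smooth_projective_model_finiteType_int`); for `p ≫ 0` there are
an injective `φ : T → W(κ)` and `ι : Frac W(κ) → ℂ` with `ι ∘ φ = (T ⊆ ℂ)`
(`CompleteLocalRings.exists_injective_ringHom_wittVector_comp_eq`); `𝒴 = Y ×_T Spec W(κ)` is smooth
and proper with projective fibres (base change; `SpreadingOutQbar.isProjectiveOver_of_isPullback_proj`);
its generic fibre becomes `X` after base change along `ι`, so it is geometrically integral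
(`SpreadingOutQbar.geometricallyIntegral_of_isPullback`), whence ALL fibres of `𝒴 → Spec W(κ)` are
geometrically irreducible by Zariski's connectedness theorem over the normal base `Spec W(κ)`
(`SpreadingOutQbar.geometricallyIrreducible_of_genericFibre`, Stacks 0AY8).

## References

* [MaulikPoonen2012] D. Maulik, B. Poonen, Néron–Severi groups under specialization, Duke Math.
  J. 161 (2012), §4.
* [Cassels1976] J. W. S. Cassels, An embedding theorem for fields, Bull. Austral. Math. Soc. 14
  (1976), Thm. I.
-/

noncomputable section

open CategoryTheory CategoryTheory.Limits AlgebraicGeometry TopologicalSpace MvPolynomial Cardinal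
open Literature.AlgebraicGeometry.HodgeTheory.SpreadingOutQbar
open Literature.RingTheory.CompleteLocalRings
open scoped Isocrystal

namespace Literature.AlgebraicGeometry.Motives

/-- **Smooth proper `W(𝔽̄_p)`-models of a complex smooth projective variety for all large primes.**
Let `X` be a smooth projective geometrically irreducible complex variety of dimension `n` and `N` a
bound. Then there are a prime `p ≥ N`, the algebraic closure `κ` of `𝔽_p`, a `W(κ)`-scheme `𝒴` which
is a smooth proper model of relative dimension `n` in the sense of `WittScheme.IsSmoothProperModel`
(smooth projective geometrically irreducible special and generic fibres), and a ring embedding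
`ι : K = Frac W(κ) → ℂ` together with an isomorphism of `ℂ`-schemes `𝒴_K ⊗_ι ℂ ≅ X`. See the module
docstring for the proof (spreading out over a finitely generated `ℤ`-algebra, Cassels' embedding
into `W(κ)` with a compatible complex embedding, base change, Zariski connectedness).
[cite: MaulikPoonen2012, §4] -/
theorem exists_isSmoothProperModel_wittVector {n : ℕ} {X : SchemeOver ℂ}
    (hX : IsSmoothProjective n X) (N : ℕ) :
    ∃ (p : ℕ) (_ : Fact p.Prime) (𝒴 : SchemeOver (WittVector p (AlgebraicClosure (ZMod p))))
      (ι : K(p, AlgebraicClosure (ZMod p)) →+* ℂ),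
      N ≤ p ∧ WittScheme.IsSmoothProperModel n 𝒴 ∧
      Nonempty ((baseChangeHom ι).obj (WittScheme.genericFibre 𝒴) ≅ X) := by
  classical
  -- A. a smooth projective model over a finitely generated `ℤ`-algebra `T ⊆ ℂ`
  obtain ⟨T, _, _, _, ψ, hψ, M, Y, g, emb, hemb, π, hembg, hgP, hgS, HX⟩ :=
    Limits.exists_smooth_projective_model_finiteType_int hX
  letI := MvPolynomial.gradedAlgebra (σ := Fin (M + 1)) (R := T)
  haveI := hemb
  haveI := hgP
  haveI := hgS
  -- B. a large prime, `κ = 𝔽̄_p`, `φ : T ↪ W(κ)` and `ι : Frac W(κ) → ℂ` with `ι ∘ φ = ψ`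
  obtain ⟨N₀, hN₀⟩ := exists_injective_ringHom_wittVector_comp_eq T ψ hψ
  obtain ⟨p, hpN, hp⟩ := Nat.exists_infinite_primes (max N N₀)
  haveI : Fact p.Prime := ⟨hp⟩
  let κ := AlgebraicClosure (ZMod p)
  haveI : CharP κ p := inferInstance
  have hκ : #κ ≤ 𝔠 :=
    (Algebra.IsAlgebraic.cardinalMk_le_max (ZMod p) κ).trans
      (max_le ((Cardinal.mk_le_aleph0 (α := ZMod p)).trans aleph0_le_continuum)
        aleph0_le_continuum)
  obtain ⟨φ, ι, hφ, hι⟩ := hN₀ p ((le_max_right _ _).trans hpN) κ hκ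
  haveI : PerfectRing κ p := PerfectField.toPerfectRing p
  set W := WittVector p κ with hW
  haveI : CharZero W := charZero_wittVector p κ
  -- C. the model `𝒴 = Y ×_T Spec W`
  set jφ : Spec (.of W) ⟶ Spec (.of T) := Spec.map (CommRingCat.ofHom φ) with hjφ
  let 𝒴 : SchemeOver W := Over.mk (pullback.snd g jφ)
  have h𝒴hom : 𝒴.hom = pullback.snd g jφ := rfl
  let a : 𝒴.left ⟶ Y := pullback.fst g jφ
  have sqW : IsPullback a 𝒴.hom g jφ := IsPullback.of_hasPullback g jφ
  haveI := smoothOfRelativeDimension_isStableUnderBaseChange (n := n)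
  haveI h𝒴S : SmoothOfRelativeDimension n 𝒴.hom :=
    MorphismProperty.pullback_snd (P := @SmoothOfRelativeDimension n) g jφ hgS
  haveI h𝒴P : IsProper 𝒴.hom := MorphismProperty.pullback_snd (P := @IsProper) g jφ hgP
  -- D. the generic fibre `𝒴_K` and its base change to `ℂ`, which is `X`
  set jK : Spec (.of K(p, κ)) ⟶ Spec (.of W) :=
    Spec.map (CommRingCat.ofHom (algebraMap W K(p, κ))) with hjK
  have hgen_left : (WittScheme.genericFibre 𝒴).left = pullback 𝒴.hom jK := rfl
  have hgen_hom : (WittScheme.genericFibre 𝒴).hom = pullback.snd 𝒴.hom jK := rfl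
  let gen : (WittScheme.genericFibre 𝒴).left ⟶ 𝒴.left := pullback.fst 𝒴.hom jK
  have sqK : IsPullback gen (WittScheme.genericFibre 𝒴).hom 𝒴.hom jK :=
    IsPullback.of_hasPullback 𝒴.hom jK
  have big : IsPullback (gen ≫ a) (WittScheme.genericFibre 𝒴).hom g (jK ≫ jφ) :=
    sqK.paste_horiz sqW
  letI : Algebra K(p, κ) ℂ := ι.toAlgebra
  set jι : Spec (.of ℂ) ⟶ Spec (.of K(p, κ)) :=
    Spec.map (CommRingCat.ofHom (algebraMap K(p, κ) ℂ)) with hjι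
  have hψfac : Spec.map (CommRingCat.ofHom ψ) = jι ≫ (jK ≫ jφ) := by
    have hψeq : ψ = (ι.comp (algebraMap W K(p, κ))).comp φ := RingHom.ext fun r => (hι r).symm
    rw [hjι, hjK, hjφ, ← Spec.map_comp, ← Spec.map_comp, ← CommRingCat.ofHom_comp,
      ← CommRingCat.ofHom_comp, hψeq]
  have HX' : IsPullback π X.hom g (jι ≫ (jK ≫ jφ)) := hψfac ▸ HX
  let ℓ : X.left ⟶ (WittScheme.genericFibre 𝒴).left :=
    big.lift π (X.hom ≫ jι) (by rw [Category.assoc]; exact HX'.w)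
  have hℓ₁ : ℓ ≫ (gen ≫ a) = π := big.lift_fst _ _ _
  have hℓ₂ : ℓ ≫ (WittScheme.genericFibre 𝒴).hom = X.hom ≫ jι := big.lift_snd _ _ _
  have SqX : IsPullback ℓ X.hom (WittScheme.genericFibre 𝒴).hom jι :=
    IsPullback.of_right (by rw [hℓ₁]; exact HX') hℓ₂ big
  -- E. geometric irreducibility of all fibres of `𝒴 → Spec W` (Zariski connectedness, Tag 0AY8)
  haveI : GeometricallyIrreducible X.hom := hX.geometricallyIrreducible
  haveI : SmoothOfRelativeDimension n (WittScheme.genericFibre 𝒴).hom :=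
    MorphismProperty.pullback_snd (P := @SmoothOfRelativeDimension n) 𝒴.hom jK h𝒴S
  haveI : Smooth (WittScheme.genericFibre 𝒴).hom :=
    SmoothOfRelativeDimension.smooth n (WittScheme.genericFibre 𝒴).hom
  haveI : GeometricallyReduced (WittScheme.genericFibre 𝒴).hom :=
    geometricallyReduced_of_smooth (WittScheme.genericFibre 𝒴).hom
  haveI hKint : GeometricallyIntegral (WittScheme.genericFibre 𝒴).hom :=
    geometricallyIntegral_of_isPullback SqX
  haveI : GeometricallyIntegral (𝒴.hom.fiberToSpecResidueField (genericPoint (Spec (.of W)))) :=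
    of_isPullback_genericFibre (R := W) (K := K(p, κ)) @GeometricallyIntegral 𝒴.hom sqK hKint
  have h𝒴irr : GeometricallyIrreducible 𝒴.hom := geometricallyIrreducible_of_genericFibre 𝒴.hom n
  -- F. the special fibre
  letI : Algebra T κ := (WittVector.constantCoeff.comp φ).toAlgebra
  set jκ : Spec (.of κ) ⟶ Spec (.of W) :=
    Spec.map (CommRingCat.ofHom (WittVector.constantCoeff : W →+* κ)) with hjκ
  have hsp_hom : (WittScheme.specialFibre 𝒴).hom = pullback.snd 𝒴.hom jκ := rfl
  have sqκ : IsPullback (pullback.fst 𝒴.hom jκ) (WittScheme.specialFibre 𝒴).hom 𝒴.hom jκ :=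
    IsPullback.of_hasPullback 𝒴.hom jκ
  have bigκ : IsPullback (pullback.fst 𝒴.hom jκ ≫ a) (WittScheme.specialFibre 𝒴).hom g
      (Spec.map (CommRingCat.ofHom (algebraMap T κ))) := by
    have h : Spec.map (CommRingCat.ofHom (algebraMap T κ)) = jκ ≫ jφ := by
      rw [hjκ, hjφ, ← Spec.map_comp, ← CommRingCat.ofHom_comp]
    rw [h]; exact sqκ.paste_horiz sqW
  have hsp : IsSmoothProjective n (WittScheme.specialFibre 𝒴) :=
    { smoothOfRelativeDimension :=
        MorphismProperty.pullback_snd (P := @SmoothOfRelativeDimension n) 𝒴.hom jκ h𝒴S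
      isProjectiveOver := isProjectiveOver_of_isPullback_proj emb hembg _ _ bigκ
      geometricallyIrreducible := by
        rw [hsp_hom]
        exact MorphismProperty.pullback_snd (P := @GeometricallyIrreducible) 𝒴.hom jκ h𝒴irr }
  -- G. the generic fibre
  letI : Algebra T K(p, κ) := ((algebraMap W K(p, κ)).comp φ).toAlgebra
  have bigK : IsPullback (gen ≫ a) (WittScheme.genericFibre 𝒴).hom g
      (Spec.map (CommRingCat.ofHom (algebraMap T K(p, κ)))) := by
    have h : Spec.map (CommRingCat.ofHom (algebraMap T K(p, κ))) = jK ≫ jφ := by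
      rw [hjK, hjφ, ← Spec.map_comp, ← CommRingCat.ofHom_comp]
    rw [h]; exact big
  have hgen : IsSmoothProjective n (WittScheme.genericFibre 𝒴) :=
    { smoothOfRelativeDimension := inferInstance
      isProjectiveOver := isProjectiveOver_of_isPullback_proj emb hembg _ _ bigK
      geometricallyIrreducible := by
        rw [hgen_hom]
        exact MorphismProperty.pullback_snd (P := @GeometricallyIrreducible) 𝒴.hom jK h𝒴irr }
  -- H. the isomorphism `𝒴_K ⊗_ι ℂ ≅ X`
  have e : (baseChangeHom ι).obj (WittScheme.genericFibre 𝒴) ≅ X :=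
    Over.isoMk SqX.isoPullback.symm (by
      change SqX.isoPullback.inv ≫ X.hom = pullback.snd (WittScheme.genericFibre 𝒴).hom jι
      exact SqX.isoPullback_inv_snd)
  exact ⟨p, ⟨hp⟩, 𝒴, ι, (le_max_left _ _).trans hpN, ⟨h𝒴S, h𝒴P, hsp, hgen⟩, ⟨e⟩⟩

/-- **Smooth PROJECTIVE `W(𝔽̄_p)`-models of a complex smooth projective variety for all large
primes** — `exists_isSmoothProperModel_wittVector` together with a closed `W(κ)`-immersion
`𝒴 ↪ ℙᴹ_{W(κ)}` over `Spec W(κ)` (the base change of `Y ↪ ℙᴹ_T`,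
`SpreadingOutQbar.exists_isClosedImmersion_pullback_proj`), i.e. the hypothesis "`X/W` smooth
projective over `W`" of Bloch–Esnault–Kerz 2014, Thm. 1.3, in raw form (a consumer obtains
`Crystalline.IsProjectiveOverRing 𝒴` from it in one line). [cite: MaulikPoonen2012, §4] -/
theorem exists_isSmoothProperModel_wittVector_proj {n : ℕ} {X : SchemeOver ℂ}
    (hX : IsSmoothProjective n X) (N : ℕ) :
    ∃ (p : ℕ) (_ : Fact p.Prime) (𝒴 : SchemeOver (WittVector p (AlgebraicClosure (ZMod p))))
      (ι : K(p, AlgebraicClosure (ZMod p)) →+* ℂ) (M : ℕ),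
      letI := MvPolynomial.gradedAlgebra (σ := Fin (M + 1)) (R := WittVector p (AlgebraicClosure (ZMod p)))
      ∃ (embW : 𝒴.left ⟶ Proj (homogeneousSubmodule (Fin (M + 1)) (WittVector p (AlgebraicClosure (ZMod p))))),
      IsClosedImmersion embW ∧
      embW ≫ ProjBaseChangeRing.projToSpec (Fin (M + 1)) (WittVector p (AlgebraicClosure (ZMod p))) = 𝒴.hom ∧
      N ≤ p ∧ WittScheme.IsSmoothProperModel n 𝒴 ∧
      Nonempty ((baseChangeHom ι).obj (WittScheme.genericFibre 𝒴) ≅ X) := by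
  classical
  -- A. a smooth projective model over a finitely generated `ℤ`-algebra `T ⊆ ℂ`
  obtain ⟨T, _, _, _, ψ, hψ, M, Y, g, emb, hemb, π, hembg, hgP, hgS, HX⟩ :=
    Limits.exists_smooth_projective_model_finiteType_int hX
  letI := MvPolynomial.gradedAlgebra (σ := Fin (M + 1)) (R := T)
  haveI := hemb
  haveI := hgP
  haveI := hgS
  -- B. a large prime, `κ = 𝔽̄_p`, `φ : T ↪ W(κ)` and `ι : Frac W(κ) → ℂ` with `ι ∘ φ = ψ`
  obtain ⟨N₀, hN₀⟩ := exists_injective_ringHom_wittVector_comp_eq T ψ hψ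
  obtain ⟨p, hpN, hp⟩ := Nat.exists_infinite_primes (max N N₀)
  haveI : Fact p.Prime := ⟨hp⟩
  let κ := AlgebraicClosure (ZMod p)
  haveI : CharP κ p := inferInstance
  have hκ : #κ ≤ 𝔠 :=
    (Algebra.IsAlgebraic.cardinalMk_le_max (ZMod p) κ).trans
      (max_le ((Cardinal.mk_le_aleph0 (α := ZMod p)).trans aleph0_le_continuum)
        aleph0_le_continuum)
  obtain ⟨φ, ι, hφ, hι⟩ := hN₀ p ((le_max_right _ _).trans hpN) κ hκ
  haveI : PerfectRing κ p := PerfectField.toPerfectRing p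
  set W := WittVector p κ with hW
  haveI : CharZero W := charZero_wittVector p κ
  -- C. the model `𝒴 = Y ×_T Spec W`
  set jφ : Spec (.of W) ⟶ Spec (.of T) := Spec.map (CommRingCat.ofHom φ) with hjφ
  let 𝒴 : SchemeOver W := Over.mk (pullback.snd g jφ)
  have h𝒴hom : 𝒴.hom = pullback.snd g jφ := rfl
  let a : 𝒴.left ⟶ Y := pullback.fst g jφ
  have sqW : IsPullback a 𝒴.hom g jφ := IsPullback.of_hasPullback g jφ
  haveI := smoothOfRelativeDimension_isStableUnderBaseChange (n := n)
  haveI h𝒴S : SmoothOfRelativeDimension n 𝒴.hom :=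
    MorphismProperty.pullback_snd (P := @SmoothOfRelativeDimension n) g jφ hgS
  haveI h𝒴P : IsProper 𝒴.hom := MorphismProperty.pullback_snd (P := @IsProper) g jφ hgP
  -- D. the generic fibre `𝒴_K` and its base change to `ℂ`, which is `X`
  set jK : Spec (.of K(p, κ)) ⟶ Spec (.of W) :=
    Spec.map (CommRingCat.ofHom (algebraMap W K(p, κ))) with hjK
  have hgen_left : (WittScheme.genericFibre 𝒴).left = pullback 𝒴.hom jK := rfl
  have hgen_hom : (WittScheme.genericFibre 𝒴).hom = pullback.snd 𝒴.hom jK := rfl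
  let gen : (WittScheme.genericFibre 𝒴).left ⟶ 𝒴.left := pullback.fst 𝒴.hom jK
  have sqK : IsPullback gen (WittScheme.genericFibre 𝒴).hom 𝒴.hom jK :=
    IsPullback.of_hasPullback 𝒴.hom jK
  have big : IsPullback (gen ≫ a) (WittScheme.genericFibre 𝒴).hom g (jK ≫ jφ) :=
    sqK.paste_horiz sqW
  letI : Algebra K(p, κ) ℂ := ι.toAlgebra
  set jι : Spec (.of ℂ) ⟶ Spec (.of K(p, κ)) :=
    Spec.map (CommRingCat.ofHom (algebraMap K(p, κ) ℂ)) with hjι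
  have hψfac : Spec.map (CommRingCat.ofHom ψ) = jι ≫ (jK ≫ jφ) := by
    have hψeq : ψ = (ι.comp (algebraMap W K(p, κ))).comp φ := RingHom.ext fun r => (hι r).symm
    rw [hjι, hjK, hjφ, ← Spec.map_comp, ← Spec.map_comp, ← CommRingCat.ofHom_comp,
      ← CommRingCat.ofHom_comp, hψeq]
  have HX' : IsPullback π X.hom g (jι ≫ (jK ≫ jφ)) := hψfac ▸ HX
  let ℓ : X.left ⟶ (WittScheme.genericFibre 𝒴).left :=
    big.lift π (X.hom ≫ jι) (by rw [Category.assoc]; exact HX'.w)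
  have hℓ₁ : ℓ ≫ (gen ≫ a) = π := big.lift_fst _ _ _
  have hℓ₂ : ℓ ≫ (WittScheme.genericFibre 𝒴).hom = X.hom ≫ jι := big.lift_snd _ _ _
  have SqX : IsPullback ℓ X.hom (WittScheme.genericFibre 𝒴).hom jι :=
    IsPullback.of_right (by rw [hℓ₁]; exact HX') hℓ₂ big
  -- E. geometric irreducibility of all fibres of `𝒴 → Spec W` (Zariski connectedness, Tag 0AY8)
  haveI : GeometricallyIrreducible X.hom := hX.geometricallyIrreducible
  haveI : SmoothOfRelativeDimension n (WittScheme.genericFibre 𝒴).hom :=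
    MorphismProperty.pullback_snd (P := @SmoothOfRelativeDimension n) 𝒴.hom jK h𝒴S
  haveI : Smooth (WittScheme.genericFibre 𝒴).hom :=
    SmoothOfRelativeDimension.smooth n (WittScheme.genericFibre 𝒴).hom
  haveI : GeometricallyReduced (WittScheme.genericFibre 𝒴).hom :=
    geometricallyReduced_of_smooth (WittScheme.genericFibre 𝒴).hom
  haveI hKint : GeometricallyIntegral (WittScheme.genericFibre 𝒴).hom :=
    geometricallyIntegral_of_isPullback SqX
  haveI : GeometricallyIntegral (𝒴.hom.fiberToSpecResidueField (genericPoint (Spec (.of W)))) :=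
    of_isPullback_genericFibre (R := W) (K := K(p, κ)) @GeometricallyIntegral 𝒴.hom sqK hKint
  have h𝒴irr : GeometricallyIrreducible 𝒴.hom := geometricallyIrreducible_of_genericFibre 𝒴.hom n
  -- F. the special fibre
  letI : Algebra T κ := (WittVector.constantCoeff.comp φ).toAlgebra
  set jκ : Spec (.of κ) ⟶ Spec (.of W) :=
    Spec.map (CommRingCat.ofHom (WittVector.constantCoeff : W →+* κ)) with hjκ
  have hsp_hom : (WittScheme.specialFibre 𝒴).hom = pullback.snd 𝒴.hom jκ := rfl
  have sqκ : IsPullback (pullback.fst 𝒴.hom jκ) (WittScheme.specialFibre 𝒴).hom 𝒴.hom jκ :=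
    IsPullback.of_hasPullback 𝒴.hom jκ
  have bigκ : IsPullback (pullback.fst 𝒴.hom jκ ≫ a) (WittScheme.specialFibre 𝒴).hom g
      (Spec.map (CommRingCat.ofHom (algebraMap T κ))) := by
    have h : Spec.map (CommRingCat.ofHom (algebraMap T κ)) = jκ ≫ jφ := by
      rw [hjκ, hjφ, ← Spec.map_comp, ← CommRingCat.ofHom_comp]
    rw [h]; exact sqκ.paste_horiz sqW
  have hsp : IsSmoothProjective n (WittScheme.specialFibre 𝒴) :=
    { smoothOfRelativeDimension :=
        MorphismProperty.pullback_snd (P := @SmoothOfRelativeDimension n) 𝒴.hom jκ h𝒴S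
      isProjectiveOver := isProjectiveOver_of_isPullback_proj emb hembg _ _ bigκ
      geometricallyIrreducible := by
        rw [hsp_hom]
        exact MorphismProperty.pullback_snd (P := @GeometricallyIrreducible) 𝒴.hom jκ h𝒴irr }
  -- G. the generic fibre
  letI : Algebra T K(p, κ) := ((algebraMap W K(p, κ)).comp φ).toAlgebra
  have bigK : IsPullback (gen ≫ a) (WittScheme.genericFibre 𝒴).hom g
      (Spec.map (CommRingCat.ofHom (algebraMap T K(p, κ)))) := by
    have h : Spec.map (CommRingCat.ofHom (algebraMap T K(p, κ))) = jK ≫ jφ := by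
      rw [hjK, hjφ, ← Spec.map_comp, ← CommRingCat.ofHom_comp]
    rw [h]; exact big
  have hgen : IsSmoothProjective n (WittScheme.genericFibre 𝒴) :=
    { smoothOfRelativeDimension := inferInstance
      isProjectiveOver := isProjectiveOver_of_isPullback_proj emb hembg _ _ bigK
      geometricallyIrreducible := by
        rw [hgen_hom]
        exact MorphismProperty.pullback_snd (P := @GeometricallyIrreducible) 𝒴.hom jK h𝒴irr }
  -- H. the isomorphism `𝒴_K ⊗_ι ℂ ≅ X`
  have e : (baseChangeHom ι).obj (WittScheme.genericFibre 𝒴) ≅ X :=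
    Over.isoMk SqX.isoPullback.symm (by
      change SqX.isoPullback.inv ≫ X.hom = pullback.snd (WittScheme.genericFibre 𝒴).hom jι
      exact SqX.isoPullback_inv_snd)
  -- I. `𝒴 ↪ ℙᴹ_W` is closed (base change of `Y ↪ ℙᴹ_T`)
  letI : Algebra T W := φ.toAlgebra
  letI := MvPolynomial.gradedAlgebra (σ := Fin (M + 1)) (R := W)
  obtain ⟨embW, hembW, hembWg⟩ : ∃ embW : pullback g jφ ⟶ Proj (homogeneousSubmodule (Fin (M + 1)) W),
      IsClosedImmersion embW ∧
        embW ≫ ProjBaseChangeRing.projToSpec (Fin (M + 1)) W = pullback.snd g jφ := by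
    have h := exists_isClosedImmersion_pullback_proj W emb
    rw [hembg] at h
    exact h
  exact ⟨p, ⟨hp⟩, 𝒴, ι, M, embW, hembW, hembWg, (le_max_left _ _).trans hpN,
    ⟨h𝒴S, h𝒴P, hsp, hgen⟩, ⟨e⟩⟩

end Literature.AlgebraicGeometry.Motives

end
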